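import Mathlib
import Summits.Ventures.HodgeRepro0.P4K3LatticeDefsM
import Summits.Ventures.HodgeRepro0.P4K3LatticeG
import Summits.Ventures.HodgeRepro0.P4K3LatticeGp
import Summits.Ventures.HodgeRepro0.P4K3LatticeIncl1
import Summits.Ventures.HodgeRepro0.P4K3LatticeIncl2

/-!
# P4K3LatticeIncl (seat p4) — `Mᵀ G' M = G` and the index relation `|det G| = 25² · |det G'|`

Closing module of the integer certificate of proofs/p4-k3-route-check.md §4 (see `P4K3LatticeDefsG`): the integer matrix `M`
expresses the basis of `Λ = ⟨B̃, exceptional curves⟩` in the ℤ-basis of `Λ′`, so `Λ ⊂ Λ′` and `[Λ′ : Λ]² = |det G| / |det G'| = 3125/5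
= 625`, i.e. `[Λ′ : Λ] = 25`. The two products are in `P4K3LatticeIncl1/2`; nothing heavy is evaluated here.
-/

namespace HodgeRepro0.P4K3Lattice

/-- `Λ ⊂ Λ′`: the Gram matrix of `Λ` is the pull-back of that of `Λ′` along `M`. -/
theorem incl : M.transpose * G' * M = G := by
  rw [← Mt_eq, Mt_mul_G', MtGp_mul_M]

/-- The index relation `|det G| = 25² · |det G'|`: `[Λ′ : Λ] = 25`. -/
theorem index_relation : |G.det| = 25 ^ 2 * |G'.det| := by
  rw [abs_det_G, abs_det_G']; norm_num

end HodgeRepro0.P4K3Lattice
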